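import Summits.QuantumFields.YangMills.Theorems.UnitScaleTiltProp7ProjRangeKernelDecayCT
import HarnessLib

/-!
# Route `UnitScaleTilt`, crux K1 «MinimiserStabilityRegPr» (stmt-QuantumFields-19200), EX row `hGF` (curved member) — **BRICK (L4-core) OF THE LOD LINE (LOCATE-P349-CT-p1g24,
# ★★OWNER RULINGS №33∕№34): THE IMS LOCALISATION FORMULA IN COMPLEX-HERMITIAN KERNEL LETTERS, AND ITS ERROR TERM AGAINST AN EXPONENTIALLY DECAYING KERNEL** — abstract,
# carrier-free (any finite index set with a pseudo-metric), the letters of ✓`Prop7ProjRangeKernelDecayCT` ∕ ✓`Prop7ProjRangeKernelDecayCoarseGram`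

Cell `ym3-torus` (HUMAN RULING D-0037, YM ladder rung R3 — NOT d = 4, NOT a mass gap, NOT Clay).  Width seat `ym-ust-19200-w5` (gen 13); chair ★`ym-ust-19200-p1` g24
(CHAIR WORD 2026-08-29 21:53Z «(L4-core) conditional GO, zero-regret class»); memo `LOCATE-L4-IMS-w5g13.md` (19200 evidence #47).  THEOREMS ONLY (0 `def`, 0 `sorry`);
`--supports stmt-QuantumFields-19200 --as helper`, count-neutral.  HONEST LABEL (№33 (6)): curved γ-row supplier line (LOD localisation), CONDITIONAL on the member bricks
(L2′)(BUMP)(L3′)(L4′)(L5′); ONE Thm 3.1-class Agmon brick (L3′) inside, Track A road cited; not N06's random walk; nothing of (3.49), Thm 3.3, `h349`, `hGF`, EX or the crux proved.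

THE MATHEMATICS (Simon 1983 ∕ Hislop–Sigal (19.54), finite index).  `A : Matrix n n ℂ`, a quadratic partition of unity `h : B → n → ℝ`, `Σ_b (h b i)² = 1`, the localised
vectors `(h_b v) i = h b i · v i`.  §1 IMS IDENTITY (exact, in `ℂ`): `Σ_b ⟨h_b v, A (h_b v)⟩ = ⟨v, A v⟩ − ½ Σ_b Σ_{i,k} (h b i − h b k)²·(v̄_i A_{ik} v_k)`, and the error term IS the
double commutator: `(D_h² A + A D_h² − 2 D_h A D_h)_{ik} = (h i − h k)²·A_{ik}` for `D_h = diagonal h` — the REAL-matrix identity is ✓`LatticeGapLargeBeta.WittenIMS.linkIMS_identity`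
(cited as the precedent; its three-line pointwise identity is re-derived inside the proof — that module imports all of Mathlib, too heavy a cone for this carrier-free core); also `Σ_b ‖h_b v‖² = ‖v‖²`.  §2 SCHUR: `|Σ_{ik} v̄_i E_{ik} v_k| ≤ ρ·Σ‖v_i‖²` when the row
AND column sums of `‖E_{ik}‖` are `≤ ρ`.  §3 THE ERROR AGAINST DECAY: if `Σ_b (h b i − h b k)² ≤ ℓ²·d(i,k)²` (joint Lipschitz constant `ℓ` of the partition in the pseudo-metric
`d`), `‖A_{ik}‖ ≤ C·e^{−μ d(i,k)}` and the second moment `Σ_k d(i,k)²e^{−μ d(i,k)} ≤ S` (rows; `d` symmetric), then the IMS error is `≤ ℓ²·C·S·Σ‖v_i‖²` — the shape the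
member's `D P D*` term takes through ✓p746782's `P_decay` (`Lip = 1∕R_cube` in block units).  §4 THE LOWER BOUNDS: local floors `σ` on vectors supported in `{h_b ≠ 0}` and an
error `≤ 2ρ‖v‖²` give `Re⟨v, Av⟩ ≥ (σ − ρ)‖v‖²`; the RELATIVE variant (error `≤ 2ρ‖v‖² + 2ρ′·Re⟨v,Av⟩`, the form the member's naked-`D` words need) gives
`(1 + ρ′)·Re⟨v, Av⟩ ≥ (σ − ρ)‖v‖²`; and the packaged «decay ⟹ floor `σ − ℓ²CS∕2`».

WHAT IS PROVED (ns `…Theorems.Prop7IMSDoubleCommutatorDecay`; `n B` finite).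
* §1 ★ `ims_identity_complex`, `sum_normSq_loc_eq`, `doubleComm_diagonal_apply` (the error term is `[D_h,[D_h,A]]` entrywise).
* §2 ★ `norm_sum_sum_le_of_row_col` (Schur test for a sesquilinear kernel sum).
* §3 ★★ `norm_imsError_le_of_decay`.
* §4 ★★ `ims_lowerBound_complex`, ★★ `ims_lowerBound_relative`, ★★★ `ims_lowerBound_of_decay`.
* §5 (v2 APPEND, ★p1 g24 pin) `sum_eq_sum_blocks`, ★★ `norm_imsError_le_of_blockBound` (block-constant cut-offs, BLOCK bilinear bounds `β(X,Y)`), ★★★ `ims_lowerBound_of_blockBound`.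
WHY IT MIGHT FAIL (№33 (2)): nothing for the algebra; at the member `ℓ = Lip(h_□) = 1∕R_cube` (block units) must make `ℓ²·C·S∕2` (+ the local `O(R⁻²)` terms) smaller than the
local floor `γ_loc ≈ γ_flat∕2`, and the cubes must fit inside the coarse torus (LOCATE-L4 §(iii): small members need their own certificate).

References: B. Simon, Ann. Inst. H. Poincaré A **38** (1983) 295–308 (IMS localisation); P. D. Hislop, I. M. Sigal, *Introduction to Spectral Theory* (1996) (19.54);
T. Bałaban, CMP **99** (1985) 389–434 [Balaban1985BackgroundPropagators] ((3.49) p.399, Thm 3.11 p.416).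
-/

set_option autoImplicit false

noncomputable section

open scoped Matrix ComplexConjugate BigOperators
open Finset

namespace Summit.QuantumFields.YangMills.Theorems.Prop7IMSDoubleCommutatorDecay

variable {n B : Type*} [Fintype n] [Fintype B]

/-! ## §1 The IMS identity in complex kernel letters -/

/-- ★ **THE IMS LOCALISATION FORMULA, COMPLEX-HERMITIAN KERNEL LETTERS** (exact identity in `ℂ`; no symmetry of `A` needed): for `A : Matrix n n ℂ`, a real quadratic partition of
unity `Σ_b (h b i)² = 1` and `v : n → ℂ`,
`Σ_b Σ_i conj(h_b i·v_i)·(A (h_b v))_i = Σ_i v̄_i (Av)_i − ½·Σ_b Σ_{i,k} (h b i − h b k)²·(v̄_i A_{ik} v_k)` — the complex twin of ✓`WittenIMS.linkIMS_identity` (real matrices),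
same proof (pointwise `Σ_b h_b(i)h_b(k) = 1 − ½Σ_b(h_b(i) − h_b(k))²`). [cite: Balaban1985BackgroundPropagators, Thm 3.11 p.416 (the coercivity it localises)] -/
theorem ims_identity_complex (A : Matrix n n ℂ) (h : B → n → ℝ) (hpart : ∀ i, ∑ b, h b i ^ 2 = 1) (v : n → ℂ) :
    ∑ b, ∑ i, star (((h b i : ℝ) : ℂ) * v i) * (A *ᵥ (fun k => ((h b k : ℝ) : ℂ) * v k)) i
      = ∑ i, star (v i) * (A *ᵥ v) i
        - (1 / 2 : ℂ) * ∑ b, ∑ i, ∑ k, (((h b i - h b k) ^ 2 : ℝ) : ℂ) * (star (v i) * A i k * v k) := by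
  classical
  -- expand both sides into triple sums over `(i, k)` with the kernel `s i k := v̄_i A_{ik} v_k`
  have hL : ∀ b, ∑ i, star (((h b i : ℝ) : ℂ) * v i) * (A *ᵥ (fun k => ((h b k : ℝ) : ℂ) * v k)) i
      = ∑ i, ∑ k, (((h b i * h b k : ℝ)) : ℂ) * (star (v i) * A i k * v k) := by
    intro b
    refine Finset.sum_congr rfl fun i _ => ?_
    rw [Matrix.mulVec, dotProduct, Finset.mul_sum]
    refine Finset.sum_congr rfl fun k _ => ?_
    rw [star_mul', Complex.star_def, Complex.conj_ofReal]
    push_cast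
    ring
  have hR : ∑ i, star (v i) * (A *ᵥ v) i = ∑ i, ∑ k, star (v i) * A i k * v k := by
    refine Finset.sum_congr rfl fun i _ => ?_
    rw [Matrix.mulVec, dotProduct, Finset.mul_sum]
    refine Finset.sum_congr rfl fun k _ => ?_
    ring
  simp_rw [hL]
  rw [hR, Finset.sum_comm]
  have h2 : ∑ b, ∑ i, ∑ k, (((h b i - h b k) ^ 2 : ℝ) : ℂ) * (star (v i) * A i k * v k)
      = ∑ i, ∑ k, ((∑ b, (h b i - h b k) ^ 2 : ℝ) : ℂ) * (star (v i) * A i k * v k) := by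
    rw [Finset.sum_comm]
    refine Finset.sum_congr rfl fun i _ => ?_
    rw [Finset.sum_comm]
    refine Finset.sum_congr rfl fun k _ => ?_
    rw [← Finset.sum_mul]
    push_cast
    rfl
  rw [h2, Finset.mul_sum, ← Finset.sum_sub_distrib]
  refine Finset.sum_congr rfl fun i _ => ?_
  rw [Finset.sum_comm, Finset.mul_sum, ← Finset.sum_sub_distrib]
  refine Finset.sum_congr rfl fun k _ => ?_
  rw [← Finset.sum_mul]
  -- the pointwise partition identity `Σ_b h_b(i)h_b(k) = 1 − ½Σ_b (h_b(i) − h_b(k))²` (= ✓`WittenIMS.sum_mul_eq_one_sub_half_sum_sq`, real letters; three lines here)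
  have hpt : ∑ b, h b i * h b k = 1 - (1 / 2) * ∑ b, (h b i - h b k) ^ 2 := by
    have hx : ∑ b, (h b i - h b k) ^ 2 = ∑ b, h b i ^ 2 + ∑ b, h b k ^ 2 - 2 * ∑ b, h b i * h b k := by
      rw [Finset.mul_sum, ← Finset.sum_add_distrib, ← Finset.sum_sub_distrib]
      exact Finset.sum_congr rfl fun b _ => by ring
    rw [hx, hpart i, hpart k]
    ring
  have key : ((∑ b, h b i * h b k : ℝ) : ℂ) = 1 - (1 / 2 : ℂ) * ((∑ b, (h b i - h b k) ^ 2 : ℝ) : ℂ) := by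
    rw [hpt]
    push_cast
    ring
  have e : (∑ b, (((h b i * h b k : ℝ)) : ℂ)) = ((∑ b, h b i * h b k : ℝ) : ℂ) := by push_cast; rfl
  rw [e, key]
  ring

/-- `Σ_b ‖h_b v‖² = ‖v‖²` for a quadratic partition of unity (complex vectors). [folklore] -/
theorem sum_normSq_loc_eq (h : B → n → ℝ) (hpart : ∀ i, ∑ b, h b i ^ 2 = 1) (v : n → ℂ) :
    ∑ b, ∑ i, ‖((h b i : ℝ) : ℂ) * v i‖ ^ 2 = ∑ i, ‖v i‖ ^ 2 := by
  rw [Finset.sum_comm]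
  refine Finset.sum_congr rfl fun i _ => ?_
  have : ∀ b, ‖((h b i : ℝ) : ℂ) * v i‖ ^ 2 = h b i ^ 2 * ‖v i‖ ^ 2 := fun b => by
    rw [norm_mul, mul_pow, Complex.norm_real, Real.norm_eq_abs, sq_abs]
  simp only [this]
  rw [← Finset.sum_mul, hpart i, one_mul]

/-- ★ **THE ERROR TERM IS THE DOUBLE COMMUTATOR**: for the diagonal multiplier `D = diagonal h`, `(D·D·A + A·D·D − 2·D·A·D)_{ik} = (h i − h k)²·A_{ik}` — i.e. the kernel of
`[D,[D,A]]` is the Hadamard product of `A` with `(h i − h k)²`. [folklore] -/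
theorem doubleComm_diagonal_apply [DecidableEq n] (A : Matrix n n ℂ) (h : n → ℝ) (i k : n) :
    (Matrix.diagonal (fun j => ((h j : ℝ) : ℂ)) * Matrix.diagonal (fun j => ((h j : ℝ) : ℂ)) * A
        + A * Matrix.diagonal (fun j => ((h j : ℝ) : ℂ)) * Matrix.diagonal (fun j => ((h j : ℝ) : ℂ))
        - (2 : ℂ) • (Matrix.diagonal (fun j => ((h j : ℝ) : ℂ)) * A * Matrix.diagonal (fun j => ((h j : ℝ) : ℂ)))) i k
      = (((h i - h k) ^ 2 : ℝ) : ℂ) * A i k := by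
  simp only [Matrix.sub_apply, Matrix.add_apply, Matrix.smul_apply, Matrix.diagonal_mul_diagonal, Matrix.mul_diagonal,
    Matrix.diagonal_mul, smul_eq_mul, Matrix.mul_assoc]
  push_cast
  ring

/-! ## §2 The Schur test for a kernel sum -/

/-- ★ **SCHUR TEST** for the sesquilinear kernel sum: if the row sums AND the column sums of `‖E_{ik}‖` are at most `ρ`, then
`‖Σ_i Σ_k v̄_i E_{ik} v_k‖ ≤ ρ·Σ_i ‖v_i‖²` (AM–GM `|v_i||v_k| ≤ (|v_i|² + |v_k|²)∕2`). [folklore] -/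
theorem norm_sum_sum_le_of_row_col (E : Matrix n n ℂ) {ρ : ℝ}
    (hrow : ∀ i, ∑ k, ‖E i k‖ ≤ ρ) (hcol : ∀ k, ∑ i, ‖E i k‖ ≤ ρ) (v : n → ℂ) :
    ‖∑ i, ∑ k, star (v i) * E i k * v k‖ ≤ ρ * ∑ i, ‖v i‖ ^ 2 := by
  -- the two half-sums, by rows and by columns
  have h1 : ∑ i, ∑ k, ‖E i k‖ * ‖v i‖ ^ 2 ≤ ρ * ∑ i, ‖v i‖ ^ 2 := by
    rw [Finset.mul_sum]
    refine Finset.sum_le_sum fun i _ => ?_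
    rw [← Finset.sum_mul]
    exact mul_le_mul_of_nonneg_right (hrow i) (sq_nonneg _)
  have h2 : ∑ i, ∑ k, ‖E i k‖ * ‖v k‖ ^ 2 ≤ ρ * ∑ k, ‖v k‖ ^ 2 := by
    rw [Finset.sum_comm, Finset.mul_sum]
    refine Finset.sum_le_sum fun k _ => ?_
    rw [← Finset.sum_mul]
    exact mul_le_mul_of_nonneg_right (hcol k) (sq_nonneg _)
  calc ‖∑ i, ∑ k, star (v i) * E i k * v k‖
      ≤ ∑ i, ∑ k, ‖star (v i) * E i k * v k‖ := (norm_sum_le _ _).trans (Finset.sum_le_sum fun i _ => norm_sum_le _ _)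
    _ = ∑ i, ∑ k, ‖E i k‖ * (‖v i‖ * ‖v k‖) := by
        refine Finset.sum_congr rfl fun i _ => Finset.sum_congr rfl fun k _ => ?_
        rw [norm_mul, norm_mul, norm_star]; ring
    _ ≤ ∑ i, ∑ k, (‖E i k‖ * ‖v i‖ ^ 2 / 2 + ‖E i k‖ * ‖v k‖ ^ 2 / 2) := by
        refine Finset.sum_le_sum fun i _ => Finset.sum_le_sum fun k _ => ?_
        have hE : 0 ≤ ‖E i k‖ := norm_nonneg _
        nlinarith [sq_nonneg (‖v i‖ - ‖v k‖), hE]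
    _ = (∑ i, ∑ k, ‖E i k‖ * ‖v i‖ ^ 2) / 2 + (∑ i, ∑ k, ‖E i k‖ * ‖v k‖ ^ 2) / 2 := by
        simp only [Finset.sum_add_distrib, Finset.sum_div]
    _ ≤ ρ * ∑ i, ‖v i‖ ^ 2 := by linarith

/-! ## §3 The IMS error against an exponentially decaying kernel -/

/-- ★★ **THE IMS ERROR AGAINST DECAY**: if the partition is jointly `ℓ`-Lipschitz in the pseudo-metric `d` (`Σ_b (h b i − h b k)² ≤ ℓ²·d(i,k)²`), the kernel decays
(`‖A_{ik}‖ ≤ C·e^{−μ d(i,k)}`, `0 ≤ C`) and the second moments are bounded (`Σ_k d(i,k)²·e^{−μ d(i,k)} ≤ S` for every row; `d` symmetric), then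
`‖Σ_b Σ_{i,k} (h b i − h b k)²·(v̄_i A_{ik} v_k)‖ ≤ ℓ²·C·S·Σ_i ‖v_i‖²` — the double commutator of a block-scale cutoff with an exponentially localised kernel is `O(ℓ²)`,
VOLUME-FREE (the shape the member's `D P D*` takes through ✓`Prop7ProjRangeKernelDecayCoarseGram.P_decay`). [cite: Balaban1985BackgroundPropagators, (3.49) p.399] -/
theorem norm_imsError_le_of_decay (A : Matrix n n ℂ) (h : B → n → ℝ) (d : n → n → ℝ) (hds : ∀ i k, d i k = d k i)
    {ℓ C μ S : ℝ} (hC : 0 ≤ C)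
    (hLip : ∀ i k, ∑ b, (h b i - h b k) ^ 2 ≤ ℓ ^ 2 * d i k ^ 2)
    (hA : ∀ i k, ‖A i k‖ ≤ C * Real.exp (-(μ * d i k)))
    (hS : ∀ i, ∑ k, d i k ^ 2 * Real.exp (-(μ * d i k)) ≤ S) (v : n → ℂ) :
    ‖∑ b, ∑ i, ∑ k, (((h b i - h b k) ^ 2 : ℝ) : ℂ) * (star (v i) * A i k * v k)‖ ≤ ℓ ^ 2 * C * S * ∑ i, ‖v i‖ ^ 2 := by
  classical
  -- regroup: the error is the kernel sum of `E i k := (Σ_b (h b i − h b k)²)·A i k`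
  set E : Matrix n n ℂ := fun i k => ((∑ b, (h b i - h b k) ^ 2 : ℝ) : ℂ) * A i k with hE
  have hsum : ∑ b, ∑ i, ∑ k, (((h b i - h b k) ^ 2 : ℝ) : ℂ) * (star (v i) * A i k * v k) = ∑ i, ∑ k, star (v i) * E i k * v k := by
    rw [Finset.sum_comm]
    refine Finset.sum_congr rfl fun i _ => ?_
    rw [Finset.sum_comm]
    refine Finset.sum_congr rfl fun k _ => ?_
    rw [← Finset.sum_mul, hE]
    push_cast
    ring
  rw [hsum]
  -- entry bound `‖E i k‖ ≤ ℓ²C·d²e^{−μd}`, symmetric in `(i,k)`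
  have hent : ∀ i k, ‖E i k‖ ≤ ℓ ^ 2 * C * (d i k ^ 2 * Real.exp (-(μ * d i k))) := by
    intro i k
    rw [hE]
    simp only
    rw [norm_mul, Complex.norm_real, Real.norm_eq_abs, abs_of_nonneg (Finset.sum_nonneg fun b _ => sq_nonneg _)]
    calc (∑ b, (h b i - h b k) ^ 2) * ‖A i k‖ ≤ (ℓ ^ 2 * d i k ^ 2) * (C * Real.exp (-(μ * d i k))) :=
          mul_le_mul (hLip i k) (hA i k) (norm_nonneg _) (by positivity)
      _ = ℓ ^ 2 * C * (d i k ^ 2 * Real.exp (-(μ * d i k))) := by ring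
  have hℓC : 0 ≤ ℓ ^ 2 * C := by positivity
  have hrow : ∀ i, ∑ k, ‖E i k‖ ≤ ℓ ^ 2 * C * S := fun i =>
    (Finset.sum_le_sum fun k _ => hent i k).trans (by rw [← Finset.mul_sum]; exact mul_le_mul_of_nonneg_left (hS i) hℓC)
  have hcol : ∀ k, ∑ i, ‖E i k‖ ≤ ℓ ^ 2 * C * S := fun k => by
    have : ∀ i, ‖E i k‖ ≤ ℓ ^ 2 * C * (d k i ^ 2 * Real.exp (-(μ * d k i))) := fun i => by rw [hds k i]; exact hent i k
    exact (Finset.sum_le_sum fun i _ => this i).trans (by rw [← Finset.mul_sum]; exact mul_le_mul_of_nonneg_left (hS k) hℓC)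
  exact norm_sum_sum_le_of_row_col E hrow hcol v

/-! ## §4 The lower bounds -/

/-- ★★ **IMS LOWER BOUND, COMPLEX LETTERS**: if every block `b` bounds `Re⟨w, Aw⟩` below by `σ·‖w‖²` on vectors supported in `{i | h b i ≠ 0}`, and the localisation error is
`≤ 2ρ‖v‖²` in norm, then `(σ − ρ)·Σ‖v_i‖² ≤ Re Σ_i v̄_i (Av)_i` — the complex twin of ✓`WittenIMS.linkIMS_lowerBound`. [cite: Balaban1985BackgroundPropagators, Thm 3.11 p.416] -/
theorem ims_lowerBound_complex (A : Matrix n n ℂ) (h : B → n → ℝ) (hpart : ∀ i, ∑ b, h b i ^ 2 = 1) {σ ρ : ℝ}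
    (hblock : ∀ (b : B) (w : n → ℂ), (∀ i, h b i = 0 → w i = 0) → σ * ∑ i, ‖w i‖ ^ 2 ≤ (∑ i, star (w i) * (A *ᵥ w) i).re)
    (herr : ∀ v : n → ℂ, ‖∑ b, ∑ i, ∑ k, (((h b i - h b k) ^ 2 : ℝ) : ℂ) * (star (v i) * A i k * v k)‖ ≤ 2 * ρ * ∑ i, ‖v i‖ ^ 2)
    (v : n → ℂ) : (σ - ρ) * ∑ i, ‖v i‖ ^ 2 ≤ (∑ i, star (v i) * (A *ᵥ v) i).re := by
  have hid := congrArg Complex.re (ims_identity_complex A h hpart v)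
  rw [Complex.re_sum] at hid
  have hloc : ∑ b, σ * ∑ i, ‖((h b i : ℝ) : ℂ) * v i‖ ^ 2
      ≤ ∑ b, (∑ i, star (((h b i : ℝ) : ℂ) * v i) * (A *ᵥ (fun k => ((h b k : ℝ) : ℂ) * v k)) i).re :=
    Finset.sum_le_sum fun b _ => hblock b (fun i => ((h b i : ℝ) : ℂ) * v i) fun i hi => by simp [hi]
  rw [← Finset.mul_sum, sum_normSq_loc_eq h hpart v, hid, Complex.sub_re] at hloc
  have he : |(((1 / 2 : ℂ) * ∑ b, ∑ i, ∑ k, (((h b i - h b k) ^ 2 : ℝ) : ℂ) * (star (v i) * A i k * v k)).re)| ≤ ρ * ∑ i, ‖v i‖ ^ 2 := by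
    refine (Complex.abs_re_le_norm _).trans ?_
    rw [norm_mul]
    have h12 : ‖(1 / 2 : ℂ)‖ = 1 / 2 := by norm_num
    rw [h12]
    have := herr v
    linarith
  have he' := (abs_le.1 he).1
  linarith

/-- ★★ **IMS LOWER BOUND, RELATIVE FORM** (the variant the member's `D P D*` term needs: its naked-`D` words are bounded against `Re⟨v, Av⟩` itself): local floors `σ` and an
error `≤ 2ρ‖v‖² + 2ρ′·Re⟨v,Av⟩` (`0 ≤ ρ′`) give `(σ − ρ)·Σ‖v_i‖² ≤ (1 + ρ′)·Re Σ_i v̄_i (Av)_i`. [cite: Balaban1985BackgroundPropagators, Thm 3.11 p.416] -/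
theorem ims_lowerBound_relative (A : Matrix n n ℂ) (h : B → n → ℝ) (hpart : ∀ i, ∑ b, h b i ^ 2 = 1) {σ ρ ρ' : ℝ}
    (hblock : ∀ (b : B) (w : n → ℂ), (∀ i, h b i = 0 → w i = 0) → σ * ∑ i, ‖w i‖ ^ 2 ≤ (∑ i, star (w i) * (A *ᵥ w) i).re)
    (herr : ∀ v : n → ℂ, ‖∑ b, ∑ i, ∑ k, (((h b i - h b k) ^ 2 : ℝ) : ℂ) * (star (v i) * A i k * v k)‖
      ≤ 2 * ρ * ∑ i, ‖v i‖ ^ 2 + 2 * ρ' * (∑ i, star (v i) * (A *ᵥ v) i).re)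
    (v : n → ℂ) : (σ - ρ) * ∑ i, ‖v i‖ ^ 2 ≤ (1 + ρ') * (∑ i, star (v i) * (A *ᵥ v) i).re := by
  have hid := congrArg Complex.re (ims_identity_complex A h hpart v)
  rw [Complex.re_sum] at hid
  have hloc : ∑ b, σ * ∑ i, ‖((h b i : ℝ) : ℂ) * v i‖ ^ 2
      ≤ ∑ b, (∑ i, star (((h b i : ℝ) : ℂ) * v i) * (A *ᵥ (fun k => ((h b k : ℝ) : ℂ) * v k)) i).re :=
    Finset.sum_le_sum fun b _ => hblock b (fun i => ((h b i : ℝ) : ℂ) * v i) fun i hi => by simp [hi]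
  rw [← Finset.mul_sum, sum_normSq_loc_eq h hpart v, hid, Complex.sub_re] at hloc
  have he : |(((1 / 2 : ℂ) * ∑ b, ∑ i, ∑ k, (((h b i - h b k) ^ 2 : ℝ) : ℂ) * (star (v i) * A i k * v k)).re)|
      ≤ ρ * ∑ i, ‖v i‖ ^ 2 + ρ' * (∑ i, star (v i) * (A *ᵥ v) i).re := by
    refine (Complex.abs_re_le_norm _).trans ?_
    rw [norm_mul]
    have h12 : ‖(1 / 2 : ℂ)‖ = 1 / 2 := by norm_num
    rw [h12]
    have := herr v
    linarith
  have he' := (abs_le.1 he).1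
  linarith

/-- ★★★ **IMS WITH AN EXPONENTIALLY LOCALISED KERNEL**: local floors `σ` on the blocks of an `ℓ`-Lipschitz quadratic partition of unity, and a kernel with `‖A_{ik}‖ ≤ Ce^{−μd(i,k)}`,
second moments `≤ S`, give the GLOBAL floor `(σ − ℓ²CS∕2)·Σ‖v_i‖² ≤ Re Σ_i v̄_i (Av)_i` — volume-free: the constants are `σ, ℓ, C, S` only.  (For a banded kernel of range `r` with
`N_r` neighbours and entries `≤ t` take `μ = 0`, `C = t`, `S = N_r·r²`.) [cite: Balaban1985BackgroundPropagators, (3.49) p.399, Thm 3.11 p.416] -/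
theorem ims_lowerBound_of_decay (A : Matrix n n ℂ) (h : B → n → ℝ) (hpart : ∀ i, ∑ b, h b i ^ 2 = 1)
    (d : n → n → ℝ) (hds : ∀ i k, d i k = d k i) {σ ℓ C μ S : ℝ} (hC : 0 ≤ C)
    (hLip : ∀ i k, ∑ b, (h b i - h b k) ^ 2 ≤ ℓ ^ 2 * d i k ^ 2)
    (hA : ∀ i k, ‖A i k‖ ≤ C * Real.exp (-(μ * d i k)))
    (hS : ∀ i, ∑ k, d i k ^ 2 * Real.exp (-(μ * d i k)) ≤ S)
    (hblock : ∀ (b : B) (w : n → ℂ), (∀ i, h b i = 0 → w i = 0) → σ * ∑ i, ‖w i‖ ^ 2 ≤ (∑ i, star (w i) * (A *ᵥ w) i).re)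
    (v : n → ℂ) : (σ - ℓ ^ 2 * C * S / 2) * ∑ i, ‖v i‖ ^ 2 ≤ (∑ i, star (v i) * (A *ᵥ v) i).re := by
  refine ims_lowerBound_complex A h hpart hblock (fun w => ?_) v
  have := norm_imsError_le_of_decay A h d hds hC hLip hA hS w
  linarith

/-! ## §5 The block edition: cut-offs constant on unit blocks, BLOCK bilinear bounds (v2 APPEND; chair ★p1 g24 pin 2026-08-29 22:17Z) -/

section Block

variable {β : Type*} [Fintype β] [DecidableEq β]

/-- Regrouping a sum over the fine index by blocks. [folklore] -/
theorem sum_eq_sum_blocks {M : Type*} [AddCommMonoid M] (blk : n → β) (F : n → M) :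
    ∑ i, F i = ∑ X, ∑ i ∈ univ.filter (fun i => blk i = X), F i :=
  (Finset.sum_fiberwise_of_maps_to (s := univ) (t := univ) (g := blk) (fun _ _ => mem_univ _) F).symm

/-- ★★ **THE IMS ERROR AGAINST BLOCK BILINEAR BOUNDS** (the block twin of `norm_imsError_le_of_decay`, in the block-`L²` currency the R3 route knows the kernel of `D P D*` in —
★p1 g24's pin): cut-offs CONSTANT ON UNIT BLOCKS (`h b i = g b (blk i)`), jointly `ℓ`-Lipschitz in the coarse pseudo-metric (`Σ_b (g b X − g b Y)² ≤ ℓ²·dc(X,Y)²`), a BLOCK bilinear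
bound `‖Σ_{i∈X,k∈Y} v̄_i A_{ik} w_k‖ ≤ β(X,Y)·‖v_X‖·‖w_Y‖` (symmetric `β ≥ 0`; the output shape of the coarse-Gram sandwich rows) and the second moment `Σ_Y dc(X,Y)²·β(X,Y) ≤ S` give
`‖Σ_b Σ_{i,k} (h b i − h b k)²·v̄_i A_{ik} v_k‖ ≤ ℓ²·S·Σ_i‖v_i‖²` — in-block pairs vanish (block-constant cut-offs), cross-block pairs by the block bound and `ab ≤ (a² + b²)∕2`; K-uniform on its face.
[cite: Balaban1985BackgroundPropagators, (3.49) p.399, Thm 3.11 p.416] -/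
theorem norm_imsError_le_of_blockBound (A : Matrix n n ℂ) (blk : n → β) (g : B → β → ℝ)
    (dc : β → β → ℝ) (βb : β → β → ℝ) (hβs : ∀ X Y, βb X Y = βb Y X) (hβ0 : ∀ X Y, 0 ≤ βb X Y) (hdcs : ∀ X Y, dc X Y = dc Y X)
    {ℓ S : ℝ}
    (hLip : ∀ X Y, ∑ b, (g b X - g b Y) ^ 2 ≤ ℓ ^ 2 * dc X Y ^ 2)
    (hA : ∀ (X Y : β) (v w : n → ℂ),
      ‖∑ i ∈ univ.filter (fun i => blk i = X), ∑ k ∈ univ.filter (fun k => blk k = Y), star (v i) * A i k * w k‖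
        ≤ βb X Y * Real.sqrt (∑ i ∈ univ.filter (fun i => blk i = X), ‖v i‖ ^ 2) * Real.sqrt (∑ k ∈ univ.filter (fun k => blk k = Y), ‖w k‖ ^ 2))
    (hS : ∀ X, ∑ Y, dc X Y ^ 2 * βb X Y ≤ S) (v : n → ℂ) :
    ‖∑ b, ∑ i, ∑ k, (((g b (blk i) - g b (blk k)) ^ 2 : ℝ) : ℂ) * (star (v i) * A i k * v k)‖ ≤ ℓ ^ 2 * S * ∑ i, ‖v i‖ ^ 2 := by
  classical
  -- block letters
  set fib : β → Finset n := fun X => univ.filter (fun i => blk i = X) with hfib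
  set a : β → ℝ := fun X => Real.sqrt (∑ i ∈ fib X, ‖v i‖ ^ 2) with ha
  set E : β → β → ℂ := fun X Y => ∑ i ∈ fib X, ∑ k ∈ fib Y, star (v i) * A i k * v k with hE
  set c : β → β → ℝ := fun X Y => ∑ b, (g b X - g b Y) ^ 2 with hc
  have ha0 : ∀ X, 0 ≤ a X := fun X => Real.sqrt_nonneg _
  have ha2 : ∀ X, a X ^ 2 = ∑ i ∈ fib X, ‖v i‖ ^ 2 := fun X => Real.sq_sqrt (Finset.sum_nonneg fun i _ => sq_nonneg _)
  have hc0 : ∀ X Y, 0 ≤ c X Y := fun X Y => Finset.sum_nonneg fun b _ => sq_nonneg _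
  -- STEP 1: regroup the error by block pairs: `error = Σ_X Σ_Y c(X,Y)·E(X,Y)`
  have hgroup : ∑ b, ∑ i, ∑ k, (((g b (blk i) - g b (blk k)) ^ 2 : ℝ) : ℂ) * (star (v i) * A i k * v k)
      = ∑ X, ∑ Y, ((c X Y : ℝ) : ℂ) * E X Y := by
    -- move `Σ_b` inside and collect the coefficient
    have h1 : ∑ b, ∑ i, ∑ k, (((g b (blk i) - g b (blk k)) ^ 2 : ℝ) : ℂ) * (star (v i) * A i k * v k)
        = ∑ i, ∑ k, ((c (blk i) (blk k) : ℝ) : ℂ) * (star (v i) * A i k * v k) := by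
      rw [Finset.sum_comm]
      refine Finset.sum_congr rfl fun i _ => ?_
      rw [Finset.sum_comm]
      refine Finset.sum_congr rfl fun k _ => ?_
      rw [← Finset.sum_mul, hc]
      push_cast
      rfl
    rw [h1, sum_eq_sum_blocks blk]
    refine Finset.sum_congr rfl fun X _ => ?_
    -- inner: Σ_{i ∈ fib X} Σ_k … = Σ_Y c(X,Y)·E(X,Y)
    have h2 : ∀ i ∈ univ.filter (fun i => blk i = X), ∑ k, ((c (blk i) (blk k) : ℝ) : ℂ) * (star (v i) * A i k * v k)
        = ∑ Y, ∑ k ∈ fib Y, ((c X Y : ℝ) : ℂ) * (star (v i) * A i k * v k) := by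
      intro i hi
      have hiX : blk i = X := (Finset.mem_filter.1 hi).2
      rw [sum_eq_sum_blocks blk]
      refine Finset.sum_congr rfl fun Y _ => Finset.sum_congr rfl fun k hk => ?_
      rw [hiX, (Finset.mem_filter.1 hk).2]
    rw [Finset.sum_congr rfl h2, Finset.sum_comm]
    refine Finset.sum_congr rfl fun Y _ => ?_
    rw [hE]
    simp only [Finset.mul_sum]
    rfl
  rw [hgroup]
  -- STEP 2: `‖E X Y‖ ≤ β(X,Y)·a_X·a_Y` and the weighted AM–GM
  have hEb : ∀ X Y, ‖E X Y‖ ≤ βb X Y * a X * a Y := fun X Y => by rw [hE, ha]; exact hA X Y v v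
  calc ‖∑ X, ∑ Y, ((c X Y : ℝ) : ℂ) * E X Y‖
      ≤ ∑ X, ∑ Y, ‖((c X Y : ℝ) : ℂ) * E X Y‖ := (norm_sum_le _ _).trans (Finset.sum_le_sum fun X _ => norm_sum_le _ _)
    _ ≤ ∑ X, ∑ Y, (ℓ ^ 2 * dc X Y ^ 2) * (βb X Y * a X * a Y) := by
        refine Finset.sum_le_sum fun X _ => Finset.sum_le_sum fun Y _ => ?_
        rw [norm_mul, Complex.norm_real, Real.norm_eq_abs, abs_of_nonneg (hc0 X Y)]
        exact mul_le_mul (hLip X Y) (hEb X Y) (norm_nonneg _) (le_trans (hc0 X Y) (hLip X Y))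
    _ ≤ ∑ X, ∑ Y, (ℓ ^ 2 * dc X Y ^ 2 * βb X Y) * ((a X ^ 2 + a Y ^ 2) / 2) := by
        refine Finset.sum_le_sum fun X _ => Finset.sum_le_sum fun Y _ => ?_
        have hw : 0 ≤ ℓ ^ 2 * dc X Y ^ 2 * βb X Y := by have := hβ0 X Y; positivity
        have hag : a X * a Y ≤ (a X ^ 2 + a Y ^ 2) / 2 := by nlinarith [sq_nonneg (a X - a Y)]
        calc ℓ ^ 2 * dc X Y ^ 2 * (βb X Y * a X * a Y) = (ℓ ^ 2 * dc X Y ^ 2 * βb X Y) * (a X * a Y) := by ring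
          _ ≤ (ℓ ^ 2 * dc X Y ^ 2 * βb X Y) * ((a X ^ 2 + a Y ^ 2) / 2) := mul_le_mul_of_nonneg_left hag hw
    _ = (∑ X, (∑ Y, ℓ ^ 2 * dc X Y ^ 2 * βb X Y) * a X ^ 2) / 2 + (∑ Y, (∑ X, ℓ ^ 2 * dc X Y ^ 2 * βb X Y) * a Y ^ 2) / 2 := by
        have e1 : ∀ X Y, (ℓ ^ 2 * dc X Y ^ 2 * βb X Y) * ((a X ^ 2 + a Y ^ 2) / 2)
            = ℓ ^ 2 * dc X Y ^ 2 * βb X Y * a X ^ 2 / 2 + ℓ ^ 2 * dc X Y ^ 2 * βb X Y * a Y ^ 2 / 2 := fun X Y => by ring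
        simp only [e1, Finset.sum_add_distrib, Finset.sum_div, Finset.sum_mul]
        congr 1
        rw [Finset.sum_comm]
    _ ≤ (∑ X, (ℓ ^ 2 * S) * a X ^ 2) / 2 + (∑ Y, (ℓ ^ 2 * S) * a Y ^ 2) / 2 := by
        have hrow : ∀ X, ∑ Y, ℓ ^ 2 * dc X Y ^ 2 * βb X Y ≤ ℓ ^ 2 * S := fun X => by
          have : ∑ Y, ℓ ^ 2 * dc X Y ^ 2 * βb X Y = ℓ ^ 2 * ∑ Y, dc X Y ^ 2 * βb X Y := by
            rw [Finset.mul_sum]; exact Finset.sum_congr rfl fun Y _ => by ring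
          rw [this]; exact mul_le_mul_of_nonneg_left (hS X) (sq_nonneg _)
        have hcol : ∀ Y, ∑ X, ℓ ^ 2 * dc X Y ^ 2 * βb X Y ≤ ℓ ^ 2 * S := fun Y => by
          have : ∑ X, ℓ ^ 2 * dc X Y ^ 2 * βb X Y = ∑ X, ℓ ^ 2 * dc Y X ^ 2 * βb Y X :=
            Finset.sum_congr rfl fun X _ => by rw [hdcs X Y, hβs X Y]
          rw [this]; exact hrow Y
        gcongr with X _ Y _
        · exact hrow X
        · exact hcol Y
    _ = ℓ ^ 2 * S * ∑ X, a X ^ 2 := by rw [← Finset.mul_sum]; ring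
    _ = ℓ ^ 2 * S * ∑ i, ‖v i‖ ^ 2 := by
        congr 1
        rw [sum_eq_sum_blocks blk (fun i => ‖v i‖ ^ 2)]
        exact Finset.sum_congr rfl fun X _ => ha2 X

/-- ★★★ **IMS WITH BLOCK BILINEAR BOUNDS — THE CLOSER** (`ims_lowerBound_complex` at `ρ = ℓ²S∕2`): block-constant quadratic partition `g` (`Σ_b (g b X)² = 1`), local floors `σ` on
the supports, block bilinear bounds `β` with second moment `S`, joint Lipschitz constant `ℓ` ⟹ `(σ − ℓ²S∕2)·Σ_i‖v_i‖² ≤ Re Σ_i v̄_i (Av)_i`, K-uniform on its face — the currency the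
member's `D P D*` arrives in through the coarse Gram route. [cite: Balaban1985BackgroundPropagators, (3.49) p.399, Thm 3.11 p.416] -/
theorem ims_lowerBound_of_blockBound (A : Matrix n n ℂ) (blk : n → β) (g : B → β → ℝ) (hgpart : ∀ X, ∑ b, g b X ^ 2 = 1)
    (dc : β → β → ℝ) (βb : β → β → ℝ) (hβs : ∀ X Y, βb X Y = βb Y X) (hβ0 : ∀ X Y, 0 ≤ βb X Y) (hdcs : ∀ X Y, dc X Y = dc Y X)
    {σ ℓ S : ℝ}
    (hLip : ∀ X Y, ∑ b, (g b X - g b Y) ^ 2 ≤ ℓ ^ 2 * dc X Y ^ 2)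
    (hA : ∀ (X Y : β) (v w : n → ℂ),
      ‖∑ i ∈ univ.filter (fun i => blk i = X), ∑ k ∈ univ.filter (fun k => blk k = Y), star (v i) * A i k * w k‖
        ≤ βb X Y * Real.sqrt (∑ i ∈ univ.filter (fun i => blk i = X), ‖v i‖ ^ 2) * Real.sqrt (∑ k ∈ univ.filter (fun k => blk k = Y), ‖w k‖ ^ 2))
    (hS : ∀ X, ∑ Y, dc X Y ^ 2 * βb X Y ≤ S)
    (hblock : ∀ (b : B) (w : n → ℂ), (∀ i, g b (blk i) = 0 → w i = 0) → σ * ∑ i, ‖w i‖ ^ 2 ≤ (∑ i, star (w i) * (A *ᵥ w) i).re)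
    (v : n → ℂ) : (σ - ℓ ^ 2 * S / 2) * ∑ i, ‖v i‖ ^ 2 ≤ (∑ i, star (v i) * (A *ᵥ v) i).re := by
  refine ims_lowerBound_complex A (fun b i => g b (blk i)) (fun i => hgpart (blk i)) hblock (fun w => ?_) v
  have := norm_imsError_le_of_blockBound A blk g dc βb hβs hβ0 hdcs hLip hA hS w
  linarith

end Block

end Summit.QuantumFields.YangMills.Theorems.Prop7IMSDoubleCommutatorDecay

end
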